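import Summits.HubbardSuperconductivity.HubbardSuperconductivity.Theorems.AnisotropyChordSpinMonotoneDefs
import Literature.MathematicalPhysics.QuantumLattice.LiebMattisLadder
import Literature.MathematicalPhysics.QuantumLattice.InfiniteVolumeLSMBondProofs
import Literature.MathematicalPhysics.QuantumLattice.XYZGroundStateOrderHolds
import Literature.MathematicalPhysics.QuantumLattice.GroundStateEnclosure

/-!
# Route `AnisotropyChord`: the TOWER INTERTWINING IDENTITY `[H(Δ), S⁺_tot] = (1−Δ) Σ_x Σ_{y∼x} S⁺_x Sᶻ_y`
# and the transition identity (★) between adjacent sector ground states (theory seat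
# `hubbard-h0-rotor-theory-1`, cycle 6, memo ROTOR-THEORY-6 §49 (I1)–(I2), PORT-SPEC §56 P-1)

For the XXZ Hamiltonian `H = J Σ_{{x,y}∈E} (Sˣ_xSˣ_y + Sʸ_xSʸ_y + Δ Sᶻ_xSᶻ_y)` of any spin `n/2` on
any finite simple graph and the total raising operator `S⁺_tot = Σ_x S⁺_x`:

* `spinBondTwo_commutator_totalRaise` — bondwise, `x ≠ y`:
  `[Sᶻ_xSᶻ_y, S⁺_tot] = S⁺_x Sᶻ_y + S⁺_y Sᶻ_x` (`[Sᶻ, S⁺] = S⁺`, locality).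
* `isingPart_commutator_totalRaise` — summed over the edges:
  `[Σ_e Sᶻ_xSᶻ_y, S⁺_tot] = Σ_x Σ_y [x ∼ y] S⁺_x Sᶻ_y` (darts ↔ edges).
* `xxz_eq_one_add_isingPart` — `H(Δ) = H(1) + J(Δ−1) Σ_e Sᶻ_xSᶻ_y`, and `H(1)` is the Heisenberg
  model (`xxz_one_eq_heisenberg_anySpin`), which commutes with `S⁺_tot` (tree:
  `commute_heisenbergHamiltonian_raise`, `totalSpin_raise_eq_sum_onSite`).
* `xxz_commutator_totalRaise` — **`[H(Δ), S⁺_tot] = J(Δ−1) Σ_xΣ_y [x∼y] S⁺_x Sᶻ_y`** (any `n, J`);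
  `towerIntertwining` — the spin-½ ferromagnet `J = −1`: `[H(Δ), S⁺_tot] = (1−Δ) Σ_xΣ_y[x∼y] S⁺_xSᶻ_y`,
  the theory seat's `TowerIntertwining` (there a `Prop`; here a theorem).
* `towerTransition_identity` — **(★)**: for sector ground states `ψ` (sector `M`, energy `E_M`) and
  `φ` (sector `M−1`, energy `E_{M−1}`) of `H(Δ) = xxzHamiltonian 1 G (−1) Δ`,
  `(E_M − E_{M−1}) ⟨ψ, S⁺_tot φ⟩ = (1−Δ) ⟨ψ, (Σ_xΣ_y[x∼y] S⁺_xSᶻ_y) φ⟩` — the tower order parameter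
  `m_W = ⟨ψ_W, S⁺_tot ψ_{W−1}⟩` of the theory seat's conjecture (TO) expressed through the
  neighbour-field operator; unconditional version of the theory seat's `towerTransition_identity`.

H. Tasaki, *Physics and Mathematics of Quantum Many-Body Systems* (2020) §2.2 eq. (2.2.6), §2.4,
§2.5 eq. (2.5.2); A. Messiah, *Quantum Mechanics* XIII.(23).  No definition is introduced.
-/

set_option linter.dupNamespace false

noncomputable section

namespace Summit.HubbardSuperconductivity.HubbardSuperconductivity.Theorems.AnisotropyChord

open Matrix Complex Finset
open Literature.MathematicalPhysics.QuantumLattice Literature.Probability.LatticeModels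

variable {Λ : Type*} [Fintype Λ] [DecidableEq Λ] (n : ℕ)

/-! ### Bondwise commutator -/

/-- For distinct sites the symmetrised `z`-bond is the plain product: `b²_{xy} = Sᶻ_x Sᶻ_y`.
Tasaki (2020) §2.4, eq. (2.4.1). [folklore] -/
theorem spinBondTwo_eq_onSite_mul {x y : Λ} (hxy : x ≠ y) :
    (spinBond n 2 x y : Op Λ (n + 1)) =
      onSite x (SpinOperators.spinZ n) * onSite y (SpinOperators.spinZ n) := by
  rw [spinBond, siteSpin, siteSpin, spinVec_two, onSite_mul_onSite_comm (Ne.symm hxy), ← two_smul ℂ,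
    smul_smul]
  norm_num

/-- The summand of `[Sᶻ_xSᶻ_y, S⁺_tot]` at site `w` (`x ≠ y`): it is `S⁺_xSᶻ_y` at `w = x`, `S⁺_ySᶻ_x`
at `w = y`, and `0` elsewhere (`[Sᶻ, S⁺] = S⁺`, operators at distinct sites commute). Tasaki (2020)
§2.1 eq. (2.1.7), §2.2 eq. (2.2.6). [folklore] -/
theorem spinZZ_commutator_onSite_raise {x y : Λ} (hxy : x ≠ y) (w : Λ) :
    (onSite x (SpinOperators.spinZ n) * onSite y (SpinOperators.spinZ n) * onSite w (spinRaise n) -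
        onSite w (spinRaise n) * (onSite x (SpinOperators.spinZ n) * onSite y (SpinOperators.spinZ n)) :
        Op Λ (n + 1)) =
      (if w = x then onSite x (spinRaise n) * onSite y (SpinOperators.spinZ n) else 0) +
        (if w = y then onSite y (spinRaise n) * onSite x (SpinOperators.spinZ n) else 0) := by
  set Zx : Op Λ (n + 1) := onSite x (SpinOperators.spinZ n) with hZx
  set Zy : Op Λ (n + 1) := onSite y (SpinOperators.spinZ n) with hZy
  set R : Op Λ (n + 1) := onSite w (spinRaise n) with hR
  by_cases hwx : w = x
  · subst hwx
    rw [if_pos rfl, if_neg hxy, add_zero]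
    -- `Z_y` commutes with `R_w = R_x`
    have hc : Zy * R = R * Zy := onSite_mul_onSite_comm (Ne.symm hxy) _ _
    have hcomm : Zx * R - R * Zx = R := onSite_spinZ_comm_spinRaise n w
    calc Zx * Zy * R - R * (Zx * Zy) = (Zx * R - R * Zx) * Zy := by
          rw [mul_assoc, hc, ← mul_assoc, sub_mul, mul_assoc R]
      _ = R * Zy := by rw [hcomm]
  · by_cases hwy : w = y
    · subst hwy
      rw [if_neg hwx, if_pos rfl, zero_add]
      have hc : Zx * R = R * Zx := onSite_mul_onSite_comm (Ne.symm hwx) _ _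
      have hcomm : Zy * R - R * Zy = R := onSite_spinZ_comm_spinRaise n w
      have hc2 : R * Zx = Zx * R := hc.symm
      calc Zx * Zy * R - R * (Zx * Zy) = Zx * (Zy * R - R * Zy) := by
            rw [mul_assoc, ← mul_assoc R, hc2, mul_assoc Zx R, mul_sub]
        _ = Zx * R := by rw [hcomm]
        _ = R * Zx := hc
    · rw [if_neg hwx, if_neg hwy, add_zero]
      have hcx : Zx * R = R * Zx := onSite_mul_onSite_comm (Ne.symm hwx) _ _
      have hcy : Zy * R = R * Zy := onSite_mul_onSite_comm (Ne.symm hwy) _ _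
      rw [mul_assoc, hcy, ← mul_assoc, hcx, mul_assoc, sub_self]

/-- **Bondwise tower commutator**: for `x ≠ y`, `[Sᶻ_xSᶻ_y, S⁺_tot] = S⁺_x Sᶻ_y + S⁺_y Sᶻ_x`.
Tasaki (2020) §2.1–§2.2. [folklore] -/
theorem spinBondTwo_commutator_totalRaise {x y : Λ} (hxy : x ≠ y) :
    (spinBond n 2 x y * (∑ w, onSite w (spinRaise n)) - (∑ w, onSite w (spinRaise n)) * spinBond n 2 x y :
        Op Λ (n + 1)) =
      onSite x (spinRaise n) * onSite y (SpinOperators.spinZ n) +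
        onSite y (spinRaise n) * onSite x (SpinOperators.spinZ n) := by
  rw [spinBondTwo_eq_onSite_mul n hxy, Finset.mul_sum, Finset.sum_mul, ← Finset.sum_sub_distrib,
    Finset.sum_congr rfl fun w _ => spinZZ_commutator_onSite_raise n hxy w, Finset.sum_add_distrib,
    Finset.sum_ite_eq' Finset.univ x, Finset.sum_ite_eq' Finset.univ y, if_pos (Finset.mem_univ _),
    if_pos (Finset.mem_univ _)]

/-! ### Summing over the edges -/

section Graph

variable (G : SimpleGraph Λ) [DecidableRel G.Adj]

/-- **`[Σ_e Sᶻ_xSᶻ_y, S⁺_tot] = Σ_x Σ_y [x ∼ y] S⁺_x Sᶻ_y`** (each edge contributes its two darts).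
Tasaki (2020) §2.2, §2.4. [folklore] -/
theorem isingPart_commutator_totalRaise :
    ((∑ e ∈ G.edgeFinset,
        Sym2.lift ⟨fun x y => (spinBond n 2 x y : Op Λ (n + 1)), fun x y => by simp only [spinBond_comm]⟩ e) *
          (∑ w, onSite w (spinRaise n)) -
        (∑ w, onSite w (spinRaise n)) *
          ∑ e ∈ G.edgeFinset,
            Sym2.lift ⟨fun x y => (spinBond n 2 x y : Op Λ (n + 1)), fun x y => by simp only [spinBond_comm]⟩ e) =
      ∑ x, ∑ y, if G.Adj x y then (onSite x (spinRaise n) * onSite y (SpinOperators.spinZ n) : Op Λ (n + 1))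
        else 0 := by
  rw [sum_sum_ite_adj_eq_sum_edgeFinset G
      (f := fun x y => (onSite x (spinRaise n) * onSite y (SpinOperators.spinZ n) : Op Λ (n + 1))),
    Finset.sum_mul, Finset.mul_sum, ← Finset.sum_sub_distrib]
  refine Finset.sum_congr rfl fun e he => ?_
  revert he
  induction e using Sym2.ind with
  | h x y =>
    intro he
    have hxy : x ≠ y := G.ne_of_adj (SimpleGraph.mem_edgeFinset.1 he)
    simp only [Sym2.lift_mk]
    exact spinBondTwo_commutator_totalRaise n hxy

/-- **`H(Δ) = H(1) + J(Δ−1) Σ_e Sᶻ_xSᶻ_y`.** [folklore] -/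
theorem xxz_eq_one_add_isingPart (J Δ : ℝ) :
    xxzHamiltonian n G J Δ = xxzHamiltonian n G J 1 +
      ((J * (Δ - 1) : ℝ) : ℂ) • ∑ e ∈ G.edgeFinset,
        Sym2.lift ⟨fun x y => (spinBond n 2 x y : Op Λ (n + 1)), fun x y => by simp only [spinBond_comm]⟩ e := by
  unfold xxzHamiltonian
  rw [Complex.ofReal_mul, mul_smul, ← smul_add]
  congr 1
  rw [Finset.smul_sum, ← Finset.sum_add_distrib]
  refine Finset.sum_congr rfl fun e _ => ?_
  induction e using Sym2.ind with
  | h x y =>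
    simp only [Sym2.lift_mk]
    push_cast
    module

/-- **`H(1)` is the Heisenberg model** (any spin, any coupling): `xxzHamiltonian n G J 1 =
heisenbergHamiltonian n G J`. Tasaki (2020) §2.4. [folklore] -/
theorem xxz_one_eq_heisenberg_anySpin (J : ℝ) :
    xxzHamiltonian n G J 1 = heisenbergHamiltonian n G J := by
  rw [xxzHamiltonian, heisenbergHamiltonian]
  congr 1
  refine Finset.sum_congr rfl fun e _ => ?_
  induction e using Sym2.ind with
  | h x y =>
    simp only [Sym2.lift_mk, spinDotSym_mk, spinDot, Fin.sum_univ_three, Complex.ofReal_one, one_smul]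

/-- `[H(1), S⁺_tot] = 0`: the isotropic point is `SU(2)`-invariant. Tasaki (2020) §2.5, eq. (2.5.2).
[folklore] -/
theorem xxz_one_commutator_totalRaise (J : ℝ) :
    (xxzHamiltonian n G J 1 * (∑ w, onSite w (spinRaise n)) -
        (∑ w, onSite w (spinRaise n)) * xxzHamiltonian n G J 1 : Op Λ (n + 1)) = 0 := by
  rw [xxz_one_eq_heisenberg_anySpin, ← LiebMattis.totalSpin_raise_eq_sum_onSite,
    (LiebMattis.commute_heisenbergHamiltonian_raise n G J).eq, sub_self]

/-- **The tower intertwining identity, general form**: for every spin `n/2`, coupling `J`,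
anisotropy `Δ` and finite simple graph,
`H(Δ) S⁺_tot − S⁺_tot H(Δ) = J(Δ−1) Σ_x Σ_y [x ∼ y] S⁺_x Sᶻ_y`.  Theory seat memo ROTOR-THEORY-6
§49 (I1); Tasaki (2020) §2.1–§2.5. [folklore] -/
theorem xxz_commutator_totalRaise (J Δ : ℝ) :
    (xxzHamiltonian n G J Δ * (∑ w, onSite w (spinRaise n)) -
        (∑ w, onSite w (spinRaise n)) * xxzHamiltonian n G J Δ : Op Λ (n + 1)) =
      ((J * (Δ - 1) : ℝ) : ℂ) •
        ∑ x, ∑ y, if G.Adj x y then (onSite x (spinRaise n) * onSite y (SpinOperators.spinZ n) : Op Λ (n + 1))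
          else 0 := by
  rw [xxz_eq_one_add_isingPart n G J Δ, add_mul, mul_add, smul_mul_assoc, mul_smul_comm,
    show ∀ A B C D : Op Λ (n + 1), A + B - (C + D) = (A - C) + (B - D) from fun A B C D => by abel,
    xxz_one_commutator_totalRaise, zero_add, ← smul_sub, isingPart_commutator_totalRaise]

/-- **TOWER INTERTWINING** (the theory seat's `TowerIntertwining`, spin ½ ferromagnet `J = −1`):
`H(Δ) S⁺_tot − S⁺_tot H(Δ) = (1−Δ) Σ_x Σ_y [x ∼ y] S⁺_x Sᶻ_y` for `H(Δ) = xxzHamiltonian 1 G (−1) Δ`.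
Theory seat memo ROTOR-THEORY-6 §49 (I1), §56 P-1. [folklore] -/
theorem towerIntertwining (Δ : ℝ) :
    (xxzHamiltonian 1 G (-1) Δ * (∑ w, onSite w (spinRaise 1)) -
        (∑ w, onSite w (spinRaise 1)) * xxzHamiltonian 1 G (-1) Δ : Op Λ 2) =
      ((1 - Δ : ℝ) : ℂ) •
        ∑ x, ∑ y, if G.Adj x y then (onSite x (spinRaise 1) * onSite y (SpinOperators.spinZ 1) : Op Λ 2)
          else 0 := by
  rw [xxz_commutator_totalRaise 1 G (-1) Δ]
  congr 1
  push_cast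
  ring

/-- **(★) The tower transition identity** (theory seat memo ROTOR-THEORY-6 §49 (I2); its Sketch6
`towerTransition_identity`, here unconditional): for sector ground states `ψ` (sector `M`) and `φ`
(sector `M−1`) of `H(Δ) = xxzHamiltonian 1 G (−1) Δ`,
`(E_M − E_{M−1}) ⟨ψ, S⁺_tot φ⟩ = (1−Δ) ⟨ψ, (Σ_xΣ_y[x∼y] S⁺_xSᶻ_y) φ⟩`.  (Only the eigen-equations
are used; `E_M, E_{M−1}` are the respective eigenvalues.) [folklore] -/
theorem towerTransition_identity (Δ M : ℝ) (ψ φ : TensorIndex Λ 2 → ℂ)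
    (hψ : xxzHamiltonian 1 G (-1) Δ *ᵥ ψ =
      ((lowestEnergyInSector 1 (xxzHamiltonian 1 G (-1) Δ) M : ℝ) : ℂ) • ψ)
    (hφ : xxzHamiltonian 1 G (-1) Δ *ᵥ φ =
      ((lowestEnergyInSector 1 (xxzHamiltonian 1 G (-1) Δ) (M - 1) : ℝ) : ℂ) • φ) :
    (((lowestEnergyInSector 1 (xxzHamiltonian 1 G (-1) Δ) M : ℝ) : ℂ) -
        ((lowestEnergyInSector 1 (xxzHamiltonian 1 G (-1) Δ) (M - 1) : ℝ) : ℂ)) *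
      (star ψ ⬝ᵥ ((∑ w, onSite w (spinRaise 1) : Op Λ 2) *ᵥ φ)) =
    ((1 - Δ : ℝ) : ℂ) * (star ψ ⬝ᵥ
      ((∑ x, ∑ y, if G.Adj x y then (onSite x (spinRaise 1) * onSite y (SpinOperators.spinZ 1) : Op Λ 2)
        else 0) *ᵥ φ)) := by
  set H := xxzHamiltonian 1 G (-1) Δ with hHdef
  set E₁ := lowestEnergyInSector 1 H M
  set E₀ := lowestEnergyInSector 1 H (M - 1)
  have hH : H.IsHermitian := xxzHamiltonian_isHermitian 1 G (-1) Δ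
  have key := towerIntertwining G Δ
  have h2 : star ψ ⬝ᵥ ((H * (∑ w, onSite w (spinRaise 1)) - (∑ w, onSite w (spinRaise 1)) * H) *ᵥ φ) =
      star ψ ⬝ᵥ ((((1 - Δ : ℝ) : ℂ) • ∑ x, ∑ y,
        if G.Adj x y then (onSite x (spinRaise 1) * onSite y (SpinOperators.spinZ 1) : Op Λ 2) else 0) *ᵥ φ) := by
    rw [key]
  rw [sub_mulVec, ← mulVec_mulVec, ← mulVec_mulVec, hφ, mulVec_smul, dotProduct_sub,
    star_dotProduct_mulVec_of_eigenvector hH hψ, dotProduct_smul, smul_mulVec,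
    dotProduct_smul, smul_eq_mul, smul_eq_mul] at h2
  rw [← h2]
  ring

end Graph

end Summit.HubbardSuperconductivity.HubbardSuperconductivity.Theorems.AnisotropyChord
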